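import Literature.AnabelianGeometry.EtaleTheta.GalSectSplittingsCohomology
import Literature.AnabelianGeometry.EtaleTheta.SettingModelTateCusp
import HarnessLib

/-!
# [GalSect] §4 torsor over `H¹` — the UN-VACUOUS instance at the STAGE-2 («Tate shear») model with a cusp (`curveχq′`)

S. Mochizuki, *Galois sections in absolute anabelian geometry* [GalSect], Nagoya Math. J. **179** (2005), §4
p. 33: "the splittings … form a torsor over `H¹(G_K, Ẑ(1))`" [cite: MochizukiGalSect2005, §4 p.33]; S. Mochizuki,
*The étale theta function …* [EtTh], Publ. RIMS **45** (2009), §1 p. 13 ("any decomposition group of a cusp"),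
Prop. 2.2 (ii) p. 37 (sections at cusps) [cite: MochizukiEtTh2009, §1 p.13].

abc-iut cell, layer L2, R78 cluster STAGE 2 (integrator abc-iut-L6-d6), seat abc-iut-w5-d029 (gen 5).  PROOF-ONLY
(0 definitions, 0 instances) stage-2 twin of this seat's `GalSectSplittingsCohomologyChi` (p432832, at the stage-1
cusp datum `curveχ′ p`): at the cusp datum `curveχq′ p i j` of `SettingModelTateCusp` (p434515: `Π^tp_X = Γ ⋊_{actχq}
G_{ℚ_p}` for the AFFINE action `a ↦ Inn(b^{κ_p^i})(a·b^{κ_p^j})`, `b ↦ b^χ`; ONE synthetic cusp with `D = b^Ẑ ⋊ G_{ℚ_p}`,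
`I = inl(b^Ẑ)`) the canonical section `σ ↦ (1, σ)` is continuous, lands in `D`, and its range IS a splitting
(`inrSplittingχq`), so — for EVERY pair of exponents `(i, j)` —

* `exists_continuous_section_cuspχq` — a continuous section `G_{ℚ_p} →ₜ* Π^tp_X` of `aug` with values in `D` whose
  range is a CLOSED splitting of the cusp (the «`sect x`» shape of GAP G-L2d3-6 at stage 2);
* `nonempty_cuspTorsorH1χq` — the [GalSect] §4 record `CuspPair.TorsorData` is inhabited at the stage-2 cusp with its
  GENUINE cohomological structure group `Ker(res : H¹(D, I) → H¹(I, I))` (this seat's generic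
  `TemperedCurve.cuspTorsorH1`, p432116).

HONEST LABEL: semi-synthetic model (synthetic `b`-axis cusp, Tate-module type Galois action; not the tempered `π₁` of a
curve) — consistency evidence for the typed interfaces only; [GalSect]/[EtTh] refereed; nothing of them asserted; typed ≠
proved; no side taken on [IUTchIII] Cor. 3.12.
-/

noncomputable section

namespace Literature.AnabelianGeometry.EtaleTheta.SettingModel

open Literature.AnabelianGeometry.SemiGraphs GalSect _root_.Topology

variable (p : ℕ) [Fact p.Prime] (i j : ℤ)

/-- **A continuous section of `aug` at the stage-2 cusp whose range is a closed splitting**: `σ ↦ (1, σ) ∈ b^Ẑ ⋊ G_{ℚ_p}`.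
[cite: MochizukiEtTh2009, Prop 2.2 (ii) p.37] -/
theorem exists_continuous_section_cuspχq :
    ∃ s : GQp p →ₜ* PiTpχq p i j, (∀ σ, augχq p i j (s σ) = σ) ∧ (∀ σ, s σ ∈ (curveχq' p i j).decomp ()) ∧
      s.toMonoidHom.range ∈ (cuspPairOf (curveχq' p i j) ()).splittings :=
  ⟨⟨SemidirectProduct.inr, continuous_inrχq p i j⟩, fun _ => rfl,
    fun σ => inr_mem_cuspDecomp (actχq p i j) (actχq_stabilises p i j) σ, inrSplittingχq p i j⟩

/-- **The [GalSect] §4 torsor at the stage-2 cusp, with its cohomological structure group**: the splitting classes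
of `(D, I) = (b^Ẑ ⋊ G_{ℚ_p}, inl(b^Ẑ))` in `Γ ⋊_{actχq} G_{ℚ_p}` form a torsor under `Ker(res) ⊆ H¹(D, I)`, based at
the canonical splitting. [cite: MochizukiGalSect2005, §4 p.33] -/
theorem nonempty_cuspTorsorH1χq :
    haveI := t2Space_PiTpχq p i j
    haveI : IsMulCommutative (cuspPairOf (curveχq' p i j) ()).I :=
      (curveχq' p i j).isMulCommutative_inertia (x := ()) trivial
    haveI := (cuspPairOf (curveχq' p i j) ()).ID_normal
    Nonempty ((cuspPairOf (curveχq' p i j) ()).TorsorData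
      ↥(ContH1.resKer (cuspPairOf (curveχq' p i j) ()).ID (⊤ : Subgroup (cuspPairOf (curveχq' p i j) ()).D)
        ((cuspPairOf (curveχq' p i j) ()).isClosedComplement_of_mem_splittings (inrSplittingχq p i j)).le_left)) :=
  haveI := t2Space_PiTpχq p i j
  ⟨(curveχq' p i j).cuspTorsorH1 (x := ()) trivial (inrSplittingχq p i j)⟩

end Literature.AnabelianGeometry.EtaleTheta.SettingModel

end
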